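import Summits.Ventures.CertifiedArithmetic.LowPrec.SRTreeIntervals
import Summits.Ventures.CertifiedArithmetic.LowPrec.SRTreeHoeffding
import HarnessLib

/-!
# Stochastic rounding into a finite format, IX: node-weighted envelopes and exponential tails from
# interval certificates

HONEST FRAMING: certified error envelopes and provably optimal rounding/accumulation schemes for
low-precision formats under stated cost models; every table by two implementations; no hardware or
vendor claims.

`SRTreeHoeffding` bounds the tail of any summation tree with ONE gap constant: `2e^{−2t²/(mG²)}`.
Here the constant becomes node-dependent. For a weight `w` on nodes, `GapLEW F w T` says that on
every branch node `v`'s candidate gap is `≤ w v`; then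

* `treeVar_le_sumSqW`: `A_T ≤ Σ_v w_v²/4` (uniform `w ≡ G` is `treeVar_le`);
* `treeExp_exp_le_W` (over `ℝ`): `NoSatT ⇒ E e^{t(ŝ_T − Σ)} ≤ e^{t² Σ_v w_v²/8}`, hence
  `tree_prob_dev_ge_le_exp_W`: `P(|ŝ_T − Σ| ≥ t) ≤ 2e^{−2t²/Σ_v w_v²}`;
* the INTERVAL weights `wI` (local spacing of each node's certified window, `SRTreeIntervals`)
  satisfy `GapLEW F (wI F) T` for every tree with no hypothesis (`gapLEW_wI`) and
  `Σ_v wI_v² = 4·envI` (`sumSqW_wI`), so `P(|ŝ_T − Σ| ≥ t) ≤ 2e^{−t²/(2·envI(T))}` under `NoSatT`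
  alone (`tree_prob_dev_ge_le_exp_I`);
* the interval data commute with `ℚ → ℝ` (`locGap_cast`, `lbT_cast`, `ubT_cast`, `envI_cast`),
  giving the tail for the rational, kernel-computed certificates (`tree_prob_dev_ge_le_exp_I_rat`):
  e.g. the balanced 32-leaf E4M3 sum of `1 + (i mod 8)/8`
  has `P(|ŝ_T − 46| ≥ t) ≤ 2e^{−t²/(31/2)}` (`Trees.e4m3_saw32_balanced_exp`), where the uniform
  constant of `SRTreeHoeffding` (`G = 32`, `m = 31`) gives only `2e^{−t²/15872}`.
-/

namespace Summit.Ventures.CertifiedArithmetic.LowPrec.SR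

open Literature.ComputerArithmetic.ConnollyHighamMary2021 Finset Real STree

section Weighted

variable {K : Type*} [Field K] [LinearOrder K] [IsStrictOrderedRing K]

/-- `GapLEW F w T`: on every branch, node `v`'s (clamped) candidate gap is `≤ w v`. -/
def GapLEW (F : Finset K) (w : STree K → K) : STree K → Prop
  | .leaf _ => True
  | .node l r => GapLEW F w l ∧ GapLEW F w r ∧ AllOut F l (fun a => AllOut F r (fun b =>
      roundUp F (clamp F (a + b)) - roundDown F (clamp F (a + b)) ≤ w (.node l r)))

/-- `Σ_{nodes v} (w v)²`. -/
def sumSqW (w : STree K → K) : STree K → K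
  | .leaf _ => 0
  | .node l r => sumSqW w l + sumSqW w r + w (.node l r) ^ 2

omit [LinearOrder K] [IsStrictOrderedRing K] in
/-- Unfolding `sumSqW` at a node. -/
theorem sumSqW_node (w : STree K → K) (l r : STree K) :
    sumSqW w (.node l r) = sumSqW w l + sumSqW w r + w (.node l r) ^ 2 := rfl

/-- `0 ≤ Σ w²`. -/
theorem sumSqW_nonneg (w : STree K → K) : ∀ T : STree K, 0 ≤ sumSqW w T
  | .leaf _ => le_rfl
  | .node l r => by
      rw [sumSqW_node]
      have := sumSqW_nonneg w l; have := sumSqW_nonneg w r; positivity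

omit [IsStrictOrderedRing K] in
/-- Uniform weights: `GapLET G ⇒ GapLEW (fun _ => G)`. -/
theorem gapLEW_const_of_gapLET (F : Finset K) (G : K) :
    ∀ T : STree K, GapLET F G T → GapLEW F (fun _ => G) T
  | .leaf _, _ => trivial
  | .node l r, ⟨hl, hr, h⟩ => ⟨gapLEW_const_of_gapLET F G l hl, gapLEW_const_of_gapLET F G r hr, h⟩

/-- Uniform weights: `Σ G² = m G²`. -/
theorem sumSqW_const (G : K) : ∀ T : STree K, sumSqW (fun _ => G) T = T.nodes * G ^ 2
  | .leaf _ => by simp [sumSqW, STree.nodes]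
  | .node l r => by
      rw [sumSqW_node, sumSqW_const G l, sumSqW_const G r]; simp only [STree.nodes]; push_cast; ring

/-- **Weighted variance envelope**: `GapLEW w ⇒ A_T ≤ Σ_v w_v²/4`. -/
theorem treeVar_le_sumSqW (F : Finset K) (w : STree K → K) : ∀ T : STree K, GapLEW F w T →
    treeVar F T ≤ sumSqW w T / 4
  | .leaf _, _ => by simp [treeVar, sumSqW]
  | .node l r, ⟨hl, hr, hg⟩ => by
      simp only [treeVar, sumSqW]
      have h1 : treeExp F l (fun a => treeExp F r (fun b => srVar F (clamp F (a + b))))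
          ≤ w (.node l r) ^ 2 / 4 := by
        refine treeExp_le_of_allOut F l (allOut_mono F l (fun a ha => ?_) hg)
        refine treeExp_le_of_allOut F r (allOut_mono F r (fun b hb => ?_) ha)
        refine (srVar_le_gap_sq_div_four F _).trans ?_
        have h0 : 0 ≤ roundUp F (clamp F (a + b)) - roundDown F (clamp F (a + b)) :=
          sub_nonneg.mpr (roundDown_le_roundUp F _)
        have := mul_self_le_mul_self h0 hb
        nlinarith [this]
      have h2 := treeVar_le_sumSqW F w l hl
      have h3 := treeVar_le_sumSqW F w r hr
      linarith

/-- The INTERVAL weights: local spacing of each node's certified window. -/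
def wI (F : Finset K) : STree K → K
  | .leaf _ => 0
  | .node l r => locGap F (dn F (lbT F l + lbT F r)) (up F (ubT F l + ubT F r))

/-- `Σ_v wI_v² = 4·envI`. -/
theorem sumSqW_wI (F : Finset K) : ∀ T : STree K, sumSqW (wI F) T = 4 * envI F T
  | .leaf _ => by simp [sumSqW, envI]
  | .node l r => by
      rw [sumSqW_node, sumSqW_wI F l, sumSqW_wI F r, envI_node]; simp only [wI]; ring

/-- **The interval weights bound every node gap on every branch, for every tree**
(no hypothesis). -/
theorem gapLEW_wI {F : Finset K} (hF : F.Nonempty) : ∀ T : STree K, GapLEW F (wI F) T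
  | .leaf _ => trivial
  | .node l r => by
      refine ⟨gapLEW_wI hF l, gapLEW_wI hF r, ?_⟩
      refine allOut_mono F l (fun a ha => ?_) (allOut_range hF l)
      refine allOut_mono F r (fun b hb => ?_) (allOut_range hF r)
      exact gap_le_locGap (dn_mem hF _) (up_mem hF _)
        ((dn_le_clamp F _).trans (clamp_mono hF (add_le_add ha.1 hb.1)))
        ((clamp_mono hF (add_le_add ha.2 hb.2)).trans (clamp_le_up F _))

end Weighted

/-! ### Node-weighted mgf and tails over `ℝ` -/

/-- **Weighted tree mgf bound**: `NoSatT ∧ GapLEW w ⇒ E e^{t(ŝ_T − Σ)} ≤ e^{t² Σ_v w_v²/8}`. -/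
theorem treeExp_exp_le_W (F : Finset ℝ) (w : STree ℝ → ℝ) (t : ℝ) : ∀ T : STree ℝ, NoSatT F T →
    GapLEW F w T → treeExp F T (fun v => exp (t * (v - T.exact))) ≤ exp (t ^ 2 * sumSqW w T / 8)
  | .leaf x, _, _ => by simp [treeExp, STree.exact, sumSqW]
  | .node l r, ⟨hl, hr, hh⟩, ⟨hgl, hgr, hg⟩ => by
      simp only [treeExp, STree.exact, sumSqW]
      have ihl := treeExp_exp_le_W F w t l hl hgl
      have ihr := treeExp_exp_le_W F w t r hr hgr
      set B1 := exp (t ^ 2 * w (.node l r) ^ 2 / 8) with hB1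
      set Br := exp (t ^ 2 * sumSqW w r / 8) with hBr
      set Bl := exp (t ^ 2 * sumSqW w l / 8) with hBl
      have hA : treeExp F l (fun a => treeExp F r (fun b =>
            step F (a + b) (fun v => exp (t * (v - (l.exact + r.exact))))))
          ≤ treeExp F l (fun a => treeExp F r (fun b =>
            exp (t * (a - l.exact)) * (B1 * exp (t * (b - r.exact))))) := by
        refine treeExp_mono_of_allOut F l (allOut_mono F l (fun a ha => ?_) (allOut_and F l hh hg))
        refine treeExp_mono_of_allOut F r
          (allOut_mono F r (fun b hb => ?_) (allOut_and F r ha.1 ha.2))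
        refine (step_exp_shift_le F hb.1 t _ hb.2).trans (le_of_eq ?_)
        rw [show t * (a + b - (l.exact + r.exact)) = t * (a - l.exact) + t * (b - r.exact) by ring,
          exp_add]
        ring
      have hB : ∀ a, treeExp F r (fun b => exp (t * (a - l.exact)) * (B1 * exp (t * (b - r.exact))))
          ≤ (B1 * Br) * exp (t * (a - l.exact)) := by
        intro a
        rw [treeExp_mul_left, treeExp_mul_left]
        have h0 : 0 ≤ exp (t * (a - l.exact)) := (exp_pos _).le
        have h1 : 0 ≤ B1 := (exp_pos _).le
        calc exp (t * (a - l.exact)) * (B1 * treeExp F r (fun b => exp (t * (b - r.exact))))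
            ≤ exp (t * (a - l.exact)) * (B1 * Br) := by gcongr
          _ = (B1 * Br) * exp (t * (a - l.exact)) := by ring
      calc treeExp F l (fun a => treeExp F r (fun b =>
              step F (a + b) (fun v => exp (t * (v - (l.exact + r.exact))))))
          ≤ treeExp F l (fun a => treeExp F r (fun b =>
              exp (t * (a - l.exact)) * (B1 * exp (t * (b - r.exact))))) := hA
        _ ≤ treeExp F l (fun a => (B1 * Br) * exp (t * (a - l.exact))) := treeExp_mono F l hB
        _ = (B1 * Br) * treeExp F l (fun a => exp (t * (a - l.exact))) := treeExp_mul_left F l _ _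
        _ ≤ (B1 * Br) * Bl := mul_le_mul_of_nonneg_left ihl (by positivity)
        _ = exp (t ^ 2 * (sumSqW w l + sumSqW w r + w (.node l r) ^ 2) / 8) := by
            rw [hB1, hBr, hBl, ← exp_add, ← exp_add]; ring_nf

/-- One-sided weighted tails (`θ ≥ 0`). -/
theorem tree_prob_updev_le_W (F : Finset ℝ) (w : STree ℝ → ℝ) (T : STree ℝ) (h : NoSatT F T)
    (hg : GapLEW F w T) (t : ℝ) {θ : ℝ} (hθ : 0 ≤ θ) :
    treeExp F T (upDevInd t T.exact) ≤ exp (-(θ * t)) * exp (θ ^ 2 * sumSqW w T / 8) ∧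
      treeExp F T (dnDevInd t T.exact) ≤ exp (-(θ * t)) * exp (θ ^ 2 * sumSqW w T / 8) := by
  constructor
  · calc treeExp F T (upDevInd t T.exact)
        ≤ treeExp F T (fun v => exp (-(θ * t)) * exp (θ * (v - T.exact))) :=
          treeExp_mono F T (fun v => upDevInd_le_exp t _ v hθ)
      _ ≤ exp (-(θ * t)) * exp (θ ^ 2 * sumSqW w T / 8) := by
          rw [treeExp_mul_left]
          exact mul_le_mul_of_nonneg_left (treeExp_exp_le_W F w θ T h hg) (exp_pos _).le
  · calc treeExp F T (dnDevInd t T.exact)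
        ≤ treeExp F T (fun v => exp (-(θ * t)) * exp (-θ * (v - T.exact))) :=
          treeExp_mono F T (fun v => dnDevInd_le_exp t _ v hθ)
      _ ≤ exp (-(θ * t)) * exp (θ ^ 2 * sumSqW w T / 8) := by
          rw [treeExp_mul_left]
          refine mul_le_mul_of_nonneg_left ?_ (exp_pos _).le
          have := treeExp_exp_le_W F w (-θ) T h hg
          rwa [neg_sq] at this

/-- **Node-weighted exponential envelope**:
`NoSatT ∧ GapLEW w ⇒ P(|ŝ_T − Σ| ≥ t) ≤ 2e^{−2t²/Σ_v w_v²}` (`t > 0`; right-hand side `2` when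
`Σ w² = 0`). -/
theorem tree_prob_dev_ge_le_exp_W (F : Finset ℝ) (w : STree ℝ → ℝ) (T : STree ℝ) (h : NoSatT F T)
    (hg : GapLEW F w T) (t : ℝ) (ht : 0 < t) :
    treeExp F T (devInd t T.exact) ≤ 2 * exp (-2 * t ^ 2 / sumSqW w T) := by
  have hsplit : treeExp F T (devInd t T.exact)
      ≤ treeExp F T (upDevInd t T.exact) + treeExp F T (dnDevInd t T.exact) := by
    rw [← treeExp_add]; exact treeExp_mono F T (fun v => devInd_le_up_add_dn t _ v)
  have hS0 := sumSqW_nonneg w T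
  by_cases hD : sumSqW w T = 0
  · have h1 := tree_prob_updev_le_W F w T h hg t le_rfl
    simp only [zero_mul, neg_zero, exp_zero, one_mul, ne_eq, zero_pow, OfNat.ofNat_ne_zero,
      not_false_eq_true, zero_div] at h1
    rw [hD, div_zero, exp_zero, mul_one]
    linarith [h1.1, h1.2]
  · have hpos : 0 < sumSqW w T := lt_of_le_of_ne hS0 (Ne.symm hD)
    set θ := 4 * t / sumSqW w T with hθ
    have hθ0 : 0 ≤ θ := by positivity
    have h1 := tree_prob_updev_le_W F w T h hg t hθ0
    have key : exp (-(θ * t)) * exp (θ ^ 2 * sumSqW w T / 8) = exp (-2 * t ^ 2 / sumSqW w T) := by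
      rw [← exp_add]; congr 1
      rw [hθ]; field_simp; ring
    rw [key] at h1
    linarith [h1.1, h1.2]

/-- **Exponential tail from the interval certificate** (over `ℝ`): for every tree and all leaves,
`NoSatT ⇒ P(|ŝ_T − Σ| ≥ t) ≤ 2e^{−t²/(2·envI(T))}`. -/
theorem tree_prob_dev_ge_le_exp_I {F : Finset ℝ} (hF : F.Nonempty) (T : STree ℝ) (h : NoSatT F T)
    (t : ℝ) (ht : 0 < t) : treeExp F T (devInd t T.exact) ≤ 2 * exp (-t ^ 2 / (2 * envI F T)) := by
  have := tree_prob_dev_ge_le_exp_W F (wI F) T h (gapLEW_wI hF T) t ht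
  rw [sumSqW_wI] at this
  refine this.trans (le_of_eq ?_)
  congr 2
  rw [show (4 : ℝ) * envI F T = 2 * (2 * envI F T) by ring, neg_mul, neg_div, neg_div,
    mul_div_mul_left _ _ (two_ne_zero)]

/-! ### The interval data commute with the cast `ℚ → ℝ` -/

section SuccF

variable {K : Type*} [Field K] [LinearOrder K] [IsStrictOrderedRing K]

omit [Field K] [IsStrictOrderedRing K] in
/-- `succF F a` is below every element of `F` above `a`. -/
theorem succF_le_of_mem {F : Finset K} {a b : K} (hb : b ∈ F) (hab : a < b) : succF F a ≤ b := by
  have hne : (F.filter (fun c => a < c)).Nonempty := ⟨b, mem_filter.mpr ⟨hb, hab⟩⟩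
  unfold succF; rw [dif_pos hne]
  exact min'_le _ _ (mem_filter.mpr ⟨hb, hab⟩)

omit [Field K] [IsStrictOrderedRing K] in
/-- Junk value: no element above `a` ⇒ `succF F a = a`. -/
theorem succF_eq_self {F : Finset K} {a : K} (h : ¬ ∃ b ∈ F, a < b) : succF F a = a := by
  unfold succF; rw [dif_neg]
  rintro ⟨b, hb⟩; exact h ⟨b, (mem_filter.mp hb).1, (mem_filter.mp hb).2⟩

end SuccF

/-- `locGap` commutes with the cast (the successor map `succF` does, pointwise). -/
theorem locGap_cast (F : Finset ℚ) (lo hi : ℚ) :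
    locGap (realImage F) (lo : ℝ) (hi : ℝ) = ((locGap F lo hi : ℚ) : ℝ) := by
  have hsucc : ∀ a : ℚ, succF (realImage F) (a : ℝ) = ((succF F a : ℚ) : ℝ) := by
    intro a
    by_cases h : ∃ b ∈ F, a < b
    · have hR : ∃ b ∈ realImage F, (a : ℝ) < b := by
        obtain ⟨b, hb, hab⟩ := h; exact ⟨b, cast_mem_realImage.mpr hb, Rat.cast_lt.mpr hab⟩
      obtain ⟨hm, hlt⟩ := succF_mem_and_lt (F := F) h
      obtain ⟨hmR, hltR⟩ := succF_mem_and_lt (F := realImage F) hR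
      apply le_antisymm
      · exact succF_le_of_mem (cast_mem_realImage.mpr hm) (Rat.cast_lt.mpr hlt)
      · obtain ⟨q, hq, hqeq⟩ := mem_realImage.mp hmR
        rw [← hqeq] at hltR ⊢
        exact_mod_cast succF_le_of_mem hq (by exact_mod_cast hltR)
    · have hR : ¬ ∃ b ∈ realImage F, (a : ℝ) < b := by
        rintro ⟨b, hb, hab⟩
        obtain ⟨q, hq, rfl⟩ := mem_realImage.mp hb
        exact h ⟨q, hq, by exact_mod_cast hab⟩
      rw [succF_eq_self h, succF_eq_self hR]
  unfold locGap
  have hfilter : (realImage F).filter (fun r => (lo : ℝ) ≤ r ∧ r < (hi : ℝ))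
      = realImage (F.filter (fun a => lo ≤ a ∧ a < hi)) := by
    unfold realImage; rw [filter_image]
    congr 1; ext a; simp only [mem_filter, Rat.cast_le, Rat.cast_lt]
  rw [hfilter]; unfold realImage
  rw [image_image]
  have hfun : ((fun r : ℝ => succF (F.image ((↑) : ℚ → ℝ)) r - r) ∘ ((↑) : ℚ → ℝ))
      = ((↑) : ℚ → ℝ) ∘ (fun a : ℚ => succF F a - a) := by
    funext a; simp only [Function.comp_apply]
    have := hsucc a; unfold realImage at this; rw [this]; push_cast; rfl
  rw [hfun, ← image_image, fold_image (fun x _ y _ hxy => Rat.cast_injective hxy)]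
  have := fold_hom (op := max) (op' := max) (b := (0 : ℚ)) (f := id)
    (s := (F.filter (fun a => lo ≤ a ∧ a < hi)).image (fun a => succF F a - a))
    (m := ((↑) : ℚ → ℝ)) (fun x y => Rat.cast_max x y)
  rw [Rat.cast_zero] at this
  exact this

/-- `lbT` commutes with the cast. -/
theorem lbT_cast (F : Finset ℚ) : ∀ T : STree ℚ,
    lbT (realImage F) (T.map ((↑) : ℚ → ℝ)) = ((lbT F T : ℚ) : ℝ)
  | .leaf _ => rfl
  | .node l r => by
      simp only [STree.map, lbT]; rw [lbT_cast F l, lbT_cast F r, ← Rat.cast_add, dn_cast]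

/-- `ubT` commutes with the cast. -/
theorem ubT_cast (F : Finset ℚ) : ∀ T : STree ℚ,
    ubT (realImage F) (T.map ((↑) : ℚ → ℝ)) = ((ubT F T : ℚ) : ℝ)
  | .leaf _ => rfl
  | .node l r => by
      simp only [STree.map, ubT]; rw [ubT_cast F l, ubT_cast F r, ← Rat.cast_add, up_cast]

/-- `envI` commutes with the cast. -/
theorem envI_cast (F : Finset ℚ) : ∀ T : STree ℚ,
    envI (realImage F) (T.map ((↑) : ℚ → ℝ)) = ((envI F T : ℚ) : ℝ)
  | .leaf _ => by simp [STree.map, envI]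
  | .node l r => by
      simp only [STree.map]
      rw [envI_node, envI_node, envI_cast F l, envI_cast F r, lbT_cast, lbT_cast, ubT_cast,
        ubT_cast, ← Rat.cast_add, ← Rat.cast_add, ← Rat.cast_add, dn_cast, up_cast, locGap_cast]
      push_cast; ring

/-- **Exponential tail from the rational interval certificate**: for a rational value set, every
tree and all leaves, `NoSatT ⇒ P(|ŝ_T − Σ| ≥ t) ≤ 2e^{−t²/(2·envI)}` with the kernel-computable
rational `envI F T`. -/
theorem tree_prob_dev_ge_le_exp_I_rat {F : Finset ℚ} (hF : F.Nonempty) (T : STree ℚ)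
    (h : NoSatT F T) (t : ℚ) (ht : 0 < t) :
    ((treeExp F T (devInd t T.exact) : ℚ) : ℝ)
      ≤ 2 * exp (-(t : ℝ) ^ 2 / (2 * ((envI F T : ℚ) : ℝ))) := by
  have hT := tree_prob_dev_ge_le_exp_I (realImage_nonempty.mpr hF) (T.map ((↑) : ℚ → ℝ))
    ((noSatT_cast F T).mpr h) (t : ℝ) (by exact_mod_cast ht)
  rw [envI_cast, exact_map_cast, treeExp_cast F T (f := devInd t T.exact) (devInd_cast t T.exact)]
    at hT
  exact hT

/-! ### Format instances -/

namespace Trees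

/-- **E4M3, balanced 32-leaf sum of `1 + (i mod 8)/8`**: `P(|ŝ_T − 46| ≥ t) ≤ 2e^{−t²/(31/2)}`
(interval certificate `envI = 31/4`; the uniform constant `G = 32`, `m = 31` of `SRTreeHoeffding`
gives only `2e^{−t²/15872}`). -/
theorem e4m3_saw32_balanced_exp (t : ℚ) (ht : 0 < t) :
    ((treeExp Formats.e4m3 (balT saw 0 5) (devInd t (balT saw 0 5).exact) : ℚ) : ℝ)
      ≤ 2 * exp (-(t : ℝ) ^ 2 / (31 / 2)) := by
  have h := tree_prob_dev_ge_le_exp_I_rat Formats.e4m3_nonempty (balT saw 0 5)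
    (noSatT_of_hullCert Formats.e4m3_nonempty _ e4m3_saw32_envI.1) t ht
  rw [e4m3_saw32_envI.2.2.1] at h
  refine h.trans (le_of_eq ?_); push_cast; norm_num

/-- **E3M2, balanced 8 leaves `(1, 5/4, 3/2, 7/4)²`**: `P(|ŝ_T − 11| ≥ t) ≤ 2e^{−2t²/7}`
(`envI = 7/4`), sequential `≤ 2e^{−4t²/29}` (`envI = 29/8`); uniform constant: `2e^{−t²/56}`. -/
theorem e3m2_oct_exp (t : ℚ) (ht : 0 < t) :
    ((treeExp Formats.e3m2 (balT oct 0 3) (devInd t (balT oct 0 3).exact) : ℚ) : ℝ)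
        ≤ 2 * exp (-2 * (t : ℝ) ^ 2 / 7) ∧
      ((treeExp Formats.e3m2 (comb (fun i => oct (i + 1)) (oct 0) 7)
          (devInd t (comb (fun i => oct (i + 1)) (oct 0) 7).exact) : ℚ) : ℝ)
        ≤ 2 * exp (-4 * (t : ℝ) ^ 2 / 29) := by
  obtain ⟨hb, hs, -, heb, -, hes⟩ := e3m2_oct_balanced_vs_sequential
  constructor
  · have h := tree_prob_dev_ge_le_exp_I_rat Formats.e3m2_nonempty (balT oct 0 3)
      (noSatT_of_hullCert Formats.e3m2_nonempty _ hb) t ht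
    rw [heb] at h
    refine h.trans (le_of_eq ?_); push_cast; ring_nf
  · have h := tree_prob_dev_ge_le_exp_I_rat Formats.e3m2_nonempty _
      (noSatT_of_hullCert Formats.e3m2_nonempty _ hs) t ht
    rw [hes] at h
    refine h.trans (le_of_eq ?_); push_cast; ring_nf

end Trees

end Summit.Ventures.CertifiedArithmetic.LowPrec.SR
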